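import Summits.HubbardSuperconductivity.HubbardSuperconductivity.Theorems.DeformationLadderLadderThesisPinnedFrameIsospectral
import HarnessLib

/-!
# Pinned spin-↑ gauge frame for `LadderThesis` (stmt-HubbardSuperconductivity-1890) — Bloch's
# twist inequality for the frames and the twist ceiling on the pinning (kill test)

* `minEnergyOn_le_re_frame`, `minEnergyOn_le_re_add_re_lsmPerturbation`,
  `minEnergyOn_le_re_add_sixteen_pi_sq` — Bloch's variational twist inequality in frame form
  (`E₀ ≤ ⟨D_k⁻¹HD_k⟩_ψ`, `E₀ ≤ ⟨H⟩_ψ + ⟨P_θ⟩_ψ`, `E₀ ≤ ⟨H⟩_ψ + 16π²` for the axis frames): the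
  `γ = σ = 0` case of the card's load-bearing `CondensateBloch`.
* `smul_re_expect_pairPenalty_le_of_groundState`, `ladderThesis_witness_ceiling` — the card's kill
  test (i): a unit sector ground state `φ` of `H + (s/L⁴)Δ_dᴴΔ_d` obeys
  `(s/L⁴)⟨Δ_dᴴΔ_d⟩_φ ≤ ⟨P_{θ_k}⟩_φ + (s/L⁴)(⟨Δ↑_d(k)ᴴΔ↑_d(k)⟩_φ + ⟨Δ↑_d(-k)ᴴΔ↑_d(-k)⟩_φ)/2`, hence a
  `LadderThesis` witness with LRO `≥ a` has `a·s ≤ 16π² + (s/2)(⟨Π_{eᵢ}⟩_φ + ⟨Π_{-eᵢ}⟩_φ)`;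
  `lowEnergyRigidity_ceiling` — the same test for the crux `LowEnergyRigidity` (stmt-1892): rigidity
  with `κ ≥ 16π²` forces pair weight `≥ a` at `±eᵢ` in every pure sector ground state.

References: Lieb–Schultz–Mattis (1961) App. B, eq. (B-5); Bohm (1949); Tada–Koma (2016) §2;
Watanabe, J. Stat. Phys. 177 (2019) 717, §2.2.
-/

noncomputable section

namespace Summit.HubbardSuperconductivity.HubbardSuperconductivity.Theorems.PinnedFrame

set_option linter.dupNamespace false

open Matrix Finset Complex Literature.MathematicalPhysics.QuantumLattice
  Literature.Probability.LatticeModels HubbardWave0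
open scoped ComplexOrder ComplexConjugate Matrix.Norms.L2Operator

variable (L : ℕ) [NeZero L]

/-! ### Bloch's variational twist inequality for the frames (`CondensateBloch` at `γ = σ = 0`) -/

omit [NeZero L] in
/-- **Bloch/Bohm variational twist inequality, frame form.** For every unit vector `ψ` of a joint
sector, the sector energy of `H_L` is at most the energy of `ψ` in ANY flat spin-↑ frame:
`E₀ ≤ Re⟨ψ, D_k⁻¹ H D_k ψ⟩` (the boosted vector `D_k ψ` stays in the sector and is a trial state).
This is the `γ = σ = 0` case of the card's `CondensateBloch`. Bohm, Phys. Rev. 75 (1949) 502;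
Tada–Koma, J. Stat. Phys. 165 (2016) 455, §2; Watanabe, J. Stat. Phys. 177 (2019) 717, §2.2. [folklore] -/
theorem minEnergyOn_le_re_frame (U : ℝ) (k : TorusSite 2 L) {N : ℕ} {M : ℝ}
    {ψ : Fock (Orb (FermionTorus 2 L))} (hψ : ψ ∈ szSector N M) (hψ1 : star ψ ⬝ᵥ ψ = 1) :
    (hubbardTorus 2 L 1 U).minEnergyOn (szSector N M) ≤
      (star ψ ⬝ᵥ ((fockTwist (-upTwistAngle L k) * hubbardTorus 2 L 1 U *
        fockTwist (upTwistAngle L k)) *ᵥ ψ)).re := by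
  have hmem : fockTwist (upTwistAngle L k) *ᵥ ψ ∈ szSector N M := fockTwist_mulVec_mem_szSector _ hψ
  have h1 : star (fockTwist (upTwistAngle L k) *ᵥ ψ) ⬝ᵥ (fockTwist (upTwistAngle L k) *ᵥ ψ) = 1 := by
    rw [star_mulVec_dotProduct, conjTranspose_fockTwist_mulVec_mulVec, hψ1]
  have h := minEnergyOn_le_rayleigh_of_mem
    (LiebThm1.hamiltonian_isHermitian (fermionTorusGraph 2 L) 1 U) _ hmem h1
  rwa [Matrix.star_mulVec_dotProduct_mulVec, conjTranspose_fockTwist] at h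

omit [NeZero L] in
/-- **Lieb–Schultz–Mattis form of Bloch's inequality.** Averaging the two opposite frames,
`E₀ ≤ Re⟨ψ, H ψ⟩ + Re⟨ψ, P_{θ_k} ψ⟩` for every unit sector vector `ψ`, with the ONE-BODY twist
functional `P_θ = lsmPerturbation` (`-T(cos(θ_u - θ_v) - 1)`): a state can lie below the ground
energy in NO frame, so its excitation energy bounds minus its twist functional.
Lieb–Schultz–Mattis (1961), App. B, eq. (B-5); Bohm (1949). [folklore] -/
theorem minEnergyOn_le_re_add_re_lsmPerturbation (U : ℝ) (k : TorusSite 2 L) {N : ℕ} {M : ℝ}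
    {ψ : Fock (Orb (FermionTorus 2 L))} (hψ : ψ ∈ szSector N M) (hψ1 : star ψ ⬝ᵥ ψ = 1) :
    (hubbardTorus 2 L 1 U).minEnergyOn (szSector N M) ≤
      (star ψ ⬝ᵥ (hubbardTorus 2 L 1 U *ᵥ ψ)).re +
        (star ψ ⬝ᵥ (lsmPerturbation (fermionTorusGraph 2 L) (upTwistAngle L k) 1 *ᵥ ψ)).re := by
  -- the frame at `k` and the opposite frame (twist `-θ_k`), both trial states
  have hplus := minEnergyOn_le_re_frame L U k hψ hψ1
  have hminus : (hubbardTorus 2 L 1 U).minEnergyOn (szSector N M) ≤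
      (star ψ ⬝ᵥ ((fockTwist (upTwistAngle L k) * hubbardTorus 2 L 1 U *
        fockTwist (-upTwistAngle L k)) *ᵥ ψ)).re := by
    have hmem : fockTwist (-upTwistAngle L k) *ᵥ ψ ∈ szSector N M :=
      fockTwist_mulVec_mem_szSector _ hψ
    have h1 : star (fockTwist (-upTwistAngle L k) *ᵥ ψ) ⬝ᵥ (fockTwist (-upTwistAngle L k) *ᵥ ψ) = 1 := by
      rw [star_mulVec_dotProduct, conjTranspose_fockTwist_mulVec_mulVec, hψ1]
    have h := minEnergyOn_le_rayleigh_of_mem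
      (LiebThm1.hamiltonian_isHermitian (fermionTorusGraph 2 L) 1 U) _ hmem h1
    rwa [Matrix.star_mulVec_dotProduct_mulVec, conjTranspose_fockTwist, neg_neg] at h
  -- add and use the LSM identity
  have hsum := congrArg (fun T => (star ψ ⬝ᵥ (T *ᵥ ψ)).re)
    (frameHamiltonian_add_frameHamiltonian_neg L U k)
  have h2 : ∀ z : ℂ, ((2 : ℂ) * z).re = 2 * z.re := fun z => by simp [Complex.mul_re]
  simp only [add_mulVec, dotProduct_add, Complex.add_re, smul_mulVec, dotProduct_smul, smul_eq_mul,
    h2] at hsum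
  linarith

/-- **Bloch's bound for the axis frames**: for every unit sector vector `ψ`,
`E₀ ≤ Re⟨ψ, Hψ⟩ + 16π²` — no state of the sector lies more than the twist cost `16π²` below... rather:
the sector ground energy exceeds no state's energy by more than the axis twist cost, i.e. the frames
`k = ±eᵢ` can lower a state's energy by at most `16π²` (`re_expect_lsmPerturbation_single_le`).
Lieb–Schultz–Mattis (1961), App. B. [folklore] -/
theorem minEnergyOn_le_re_add_sixteen_pi_sq (hL : 2 ≤ L) (U : ℝ) (i : Fin 2) {N : ℕ} {M : ℝ}
    {ψ : Fock (Orb (FermionTorus 2 L))} (hψ : ψ ∈ szSector N M) (hψ1 : star ψ ⬝ᵥ ψ = 1) :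
    (hubbardTorus 2 L 1 U).minEnergyOn (szSector N M) ≤
      (star ψ ⬝ᵥ (hubbardTorus 2 L 1 U *ᵥ ψ)).re + 16 * Real.pi ^ 2 := by
  have h := minEnergyOn_le_re_add_re_lsmPerturbation L U (Pi.single i 1) hψ hψ1
  have hP := re_expect_lsmPerturbation_single_le L hL i ψ
  rw [hψ1, Complex.one_re, mul_one] at hP
  linarith

/-! ### The ceiling on the pinning: a penalised ground state is pinned by at most the twist cost -/

/-- **Twist ceiling on the zero-mode pinning of a penalised ground state (the card's kill test).**
Let `φ` be a unit ground state of `H_L + (s/L⁴) Δ_dᴴΔ_d` in a joint sector. Testing the penalised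
matrix on the two boosted copies `D_k^{∓1} φ` (which stay in the sector) and adding — covariance
turns the zero-mode penalty into the penalties at `±k`, the Lieb–Schultz–Mattis identity turns the
two boosted kinetic energies into `2⟨H⟩ + 2⟨P_{θ_k}⟩` — gives
`(s/L⁴)⟨Δ_dᴴΔ_d⟩_φ ≤ ⟨P_{θ_k}⟩_φ + (s/L⁴)·(⟨Δ↑_d(k)ᴴΔ↑_d(k)⟩_φ + ⟨Δ↑_d(-k)ᴴΔ↑_d(-k)⟩_φ)/2`:
the zero mode of a penalised ground state is pinned by at most the one-body twist functional,
unless the state itself carries pair weight at `±k`. Lieb–Schultz–Mattis (1961), App. B; Bohm (1949);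
the card `pinned-up-gauge-frame`, Why-it-bites (1). [folklore] -/
theorem smul_re_expect_pairPenalty_le_of_groundState (U : ℝ) (s : ℝ) (k : TorusSite 2 L)
    {N : ℕ} {M : ℝ} {φ : Fock (Orb (FermionTorus 2 L))} (hφ1 : star φ ⬝ᵥ φ = 1)
    (hφ : IsGroundStateInSector (hubbardTorus 2 L 1 U + ((s / (L : ℝ) ^ 4 : ℝ) : ℂ) •
      ((pairField dWaveFormFactor L)ᴴ * pairField dWaveFormFactor L)) N M φ) :
    s / (L : ℝ) ^ 4 * (star φ ⬝ᵥ (((pairField dWaveFormFactor L)ᴴ * pairField dWaveFormFactor L) *ᵥ φ)).re ≤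
      (star φ ⬝ᵥ (lsmPerturbation (fermionTorusGraph 2 L) (upTwistAngle L k) 1 *ᵥ φ)).re +
        s / (L : ℝ) ^ 4 / 2 *
          ((star φ ⬝ᵥ (((upPairFieldAt dWaveFormFactor L k)ᴴ * upPairFieldAt dWaveFormFactor L k) *ᵥ φ)).re +
           (star φ ⬝ᵥ (((upPairFieldAt dWaveFormFactor L (-k))ᴴ *
              upPairFieldAt dWaveFormFactor L (-k)) *ᵥ φ)).re) := by
  obtain ⟨hmem, -, heig⟩ := hφ
  set θ := upTwistAngle L k with hθ
  set P₀ := (pairField dWaveFormFactor L)ᴴ * pairField dWaveFormFactor L with hP₀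
  set A := hubbardTorus 2 L 1 U + ((s / (L : ℝ) ^ 4 : ℝ) : ℂ) • P₀ with hA
  have hAh : A.IsHermitian :=
    isHermitian_add_real_smul_penalty (LiebThm1.hamiltonian_isHermitian (fermionTorusGraph 2 L) 1 U) _ _
  -- the ground-state energy read on `φ`
  have hEs : (star φ ⬝ᵥ (A *ᵥ φ)).re = A.minEnergyOn (szSector N M) := by
    rw [heig, dotProduct_smul, hφ1, smul_eq_mul, mul_one, Complex.ofReal_re]
  have hEφ : (star φ ⬝ᵥ (A *ᵥ φ)).re = (star φ ⬝ᵥ (hubbardTorus 2 L 1 U *ᵥ φ)).re +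
      s / (L : ℝ) ^ 4 * (star φ ⬝ᵥ (P₀ *ᵥ φ)).re := by
    rw [hA, add_mulVec, dotProduct_add, Complex.add_re, smul_mulVec, dotProduct_smul, smul_eq_mul,
      Complex.re_ofReal_mul]
  -- trial state 1: `D_k⁻¹ φ`
  have h1 : A.minEnergyOn (szSector N M) ≤
      (star φ ⬝ᵥ ((fockTwist θ * hubbardTorus 2 L 1 U * fockTwist (-θ)) *ᵥ φ)).re +
        s / (L : ℝ) ^ 4 * (star φ ⬝ᵥ (((upPairFieldAt dWaveFormFactor L k)ᴴ *
          upPairFieldAt dWaveFormFactor L k) *ᵥ φ)).re := by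
    have hm := fockTwist_mulVec_mem_szSector (-θ) hmem
    have hu : star (fockTwist (-θ) *ᵥ φ) ⬝ᵥ (fockTwist (-θ) *ᵥ φ) = 1 := by
      rw [star_mulVec_dotProduct, conjTranspose_fockTwist_mulVec_mulVec, hφ1]
    have h := minEnergyOn_le_rayleigh_of_mem hAh _ hm hu
    rwa [Matrix.star_mulVec_dotProduct_mulVec, conjTranspose_fockTwist, neg_neg, hA, Matrix.mul_add,
      Matrix.add_mul, Matrix.mul_smul, Matrix.smul_mul, hP₀, hθ, fockTwist_conj_pairPenalty_dWave,
      add_mulVec, dotProduct_add, Complex.add_re, smul_mulVec, dotProduct_smul, smul_eq_mul,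
      Complex.re_ofReal_mul] at h
  -- trial state 2: `D_k φ`, whose inverse boost is the boost of winding `-k`
  have hPneg : fockTwist (-θ) * P₀ * fockTwist θ =
      (upPairFieldAt dWaveFormFactor L (-k))ᴴ * upPairFieldAt dWaveFormFactor L (-k) := by
    rw [hθ, ← fockTwist_upTwistAngle_neg, show fockTwist (upTwistAngle L k) =
      fockTwist (-upTwistAngle L (-k)) by rw [← fockTwist_upTwistAngle_neg, neg_neg], hP₀,
      fockTwist_conj_pairPenalty_dWave]
  have h2 : A.minEnergyOn (szSector N M) ≤
      (star φ ⬝ᵥ ((fockTwist (-θ) * hubbardTorus 2 L 1 U * fockTwist θ) *ᵥ φ)).re +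
        s / (L : ℝ) ^ 4 * (star φ ⬝ᵥ (((upPairFieldAt dWaveFormFactor L (-k))ᴴ *
          upPairFieldAt dWaveFormFactor L (-k)) *ᵥ φ)).re := by
    have hm := fockTwist_mulVec_mem_szSector θ hmem
    have hu : star (fockTwist θ *ᵥ φ) ⬝ᵥ (fockTwist θ *ᵥ φ) = 1 := by
      rw [star_mulVec_dotProduct, conjTranspose_fockTwist_mulVec_mulVec, hφ1]
    have h := minEnergyOn_le_rayleigh_of_mem hAh _ hm hu
    rwa [Matrix.star_mulVec_dotProduct_mulVec, conjTranspose_fockTwist, hA, Matrix.mul_add,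
      Matrix.add_mul, Matrix.mul_smul, Matrix.smul_mul, hPneg,
      add_mulVec, dotProduct_add, Complex.add_re, smul_mulVec, dotProduct_smul, smul_eq_mul,
      Complex.re_ofReal_mul] at h
  -- the LSM identity in form language
  have htwo : ∀ z : ℂ, ((2 : ℂ) * z).re = 2 * z.re := fun z => by simp [Complex.mul_re]
  have hsum := congrArg (fun T => (star φ ⬝ᵥ (T *ᵥ φ)).re)
    (frameHamiltonian_add_frameHamiltonian_neg L U k)
  simp only [add_mulVec, dotProduct_add, Complex.add_re, smul_mulVec, dotProduct_smul, smul_eq_mul,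
    htwo] at hsum
  rw [← hθ] at hsum
  -- assemble: 2E_s ≤ 2⟨H⟩ + 2⟨P_θ⟩ + c(⟨P_k⟩ + ⟨P_{-k}⟩) and E_s = ⟨H⟩ + c⟨P₀⟩
  have hE := hEs.symm.trans hEφ
  nlinarith [h1, h2, hsum, hE]

open Summit.HubbardSuperconductivity.HubbardSuperconductivity.Theses.DeformationLadder in
/-- **Kill test for `LadderThesis` witnesses (axis frames).** If `φ` is a unit sector ground state
of `H_L + (s/L⁴)Δ_dᴴΔ_d` (`s ≥ 0`, `L ≥ 2`) with d-wave LRO density `≥ a` — exactly the witness the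
crux `LadderThesis` asks for — then
`a·s ≤ 16π² + (s/2)·(⟨Π_{eᵢ}⟩_φ + ⟨Π_{-eᵢ}⟩_φ)`, `Π_k = L⁻⁴ Δ↑_d(k)ᴴΔ↑_d(k)`:
unless the penalised ground state itself carries d-wave pair weight at the first nonzero pair
momenta `±eᵢ`, the pinning `a·s` is bounded by the spin-↑ twist cost `16π²` (the crux's `∃ s` is
not cosmetic). Lieb–Schultz–Mattis (1961), App. B; the card `pinned-up-gauge-frame`, kill test (i). [folklore] -/
theorem ladderThesis_witness_ceiling (hL : 2 ≤ L) (U : ℝ) {s a : ℝ} (hs : 0 ≤ s) (i : Fin 2)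
    {N : ℕ} {M : ℝ} {φ : Fock (Orb (FermionTorus 2 L))} (hφ1 : star φ ⬝ᵥ φ = 1)
    (hφ : IsGroundStateInSector (hubbardTorus 2 L 1 U + ((s / (L : ℝ) ^ 4 : ℝ) : ℂ) •
      ((pairField dWaveFormFactor L)ᴴ * pairField dWaveFormFactor L)) N M φ)
    (ha : a ≤ (expect ((pairField dWaveFormFactor L)ᴴ * pairField dWaveFormFactor L) φ).re /
      (L : ℝ) ^ 4) :
    a * s ≤ 16 * Real.pi ^ 2 + s / 2 *
      ((expect ((upPairFieldAt dWaveFormFactor L (Pi.single i 1))ᴴ *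
          upPairFieldAt dWaveFormFactor L (Pi.single i 1)) φ).re / (L : ℝ) ^ 4 +
        (expect ((upPairFieldAt dWaveFormFactor L (-Pi.single i 1))ᴴ *
          upPairFieldAt dWaveFormFactor L (-Pi.single i 1)) φ).re / (L : ℝ) ^ 4) := by
  have hL4 : (0 : ℝ) < (L : ℝ) ^ 4 := by
    have : (0 : ℝ) < L := by exact_mod_cast Nat.pos_of_ne_zero (NeZero.ne L)
    positivity
  have hmain := smul_re_expect_pairPenalty_le_of_groundState L U s (Pi.single i 1) hφ1 hφ
  have hP := re_expect_lsmPerturbation_single_le L hL i φ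
  rw [hφ1, Complex.one_re, mul_one] at hP
  simp only [Literature.MathematicalPhysics.QuantumLattice.expect] at ha ⊢
  have ha' : a * s ≤ s / (L : ℝ) ^ 4 *
      (star φ ⬝ᵥ (((pairField dWaveFormFactor L)ᴴ * pairField dWaveFormFactor L) *ᵥ φ)).re := by
    rw [div_mul_eq_mul_div, le_div_iff₀ hL4, mul_comm s]
    have := mul_le_mul_of_nonneg_right ha (mul_nonneg hs hL4.le)
    calc a * s * (L : ℝ) ^ 4 = a * (s * (L : ℝ) ^ 4) := by ring
      _ ≤ (star φ ⬝ᵥ (((pairField dWaveFormFactor L)ᴴ * pairField dWaveFormFactor L) *ᵥ φ)).re /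
            (L : ℝ) ^ 4 * (s * (L : ℝ) ^ 4) := this
      _ = (star φ ⬝ᵥ (((pairField dWaveFormFactor L)ᴴ * pairField dWaveFormFactor L) *ᵥ φ)).re * s := by
            field_simp
  have hrhs : s / (L : ℝ) ^ 4 / 2 *
      ((star φ ⬝ᵥ (((upPairFieldAt dWaveFormFactor L (Pi.single i 1))ᴴ *
          upPairFieldAt dWaveFormFactor L (Pi.single i 1)) *ᵥ φ)).re +
        (star φ ⬝ᵥ (((upPairFieldAt dWaveFormFactor L (-Pi.single i 1))ᴴ *
          upPairFieldAt dWaveFormFactor L (-Pi.single i 1)) *ᵥ φ)).re) =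
      s / 2 * ((star φ ⬝ᵥ (((upPairFieldAt dWaveFormFactor L (Pi.single i 1))ᴴ *
          upPairFieldAt dWaveFormFactor L (Pi.single i 1)) *ᵥ φ)).re / (L : ℝ) ^ 4 +
        (star φ ⬝ᵥ (((upPairFieldAt dWaveFormFactor L (-Pi.single i 1))ᴴ *
          upPairFieldAt dWaveFormFactor L (-Pi.single i 1)) *ᵥ φ)).re / (L : ℝ) ^ 4) := by
    field_simp
  linarith

/-- **Twist ceiling for `LowEnergyRigidity` (stmt-1892): rigidity above the twist scale forces
finite-momentum pair weight in the PURE ground state.** Fix the data `(U, N, κ, a)` of a low-energy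
rigidity statement at one side `L ≥ 2` (every unit sector vector within `κ` of the sector energy has
`L⁻⁴ Re⟨Δ_dᴴΔ_d⟩ ≥ a`). If `κ ≥ 16π²`, then every unit sector ground state `ψ` of the pure torus
`H_L` carries pair weight `≥ a` at pair momentum `eᵢ` or at `-eᵢ`: one of the two boosted copies
`D_{eᵢ}^{∓1}ψ` lies within `⟨P_{θ_{eᵢ}}⟩_ψ ≤ 16π² ≤ κ` of the ground energy (LSM identity), so it is
rigid, and its zero-mode weight is `ψ`'s weight at `±eᵢ` (covariance). This is the refuter's
"one-flux twist" constraint `κ < 2π²K` on the crux, in the exactly covariant spin-↑ dress.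
Lieb–Schultz–Mattis (1961), App. B; route-review notes on stmt-1892 (2026-08-15). [folklore] -/
theorem lowEnergyRigidity_ceiling (hL : 2 ≤ L) (U : ℝ) {κ a : ℝ} {N : ℕ}
    (hrig : ∀ φ : Fock (Orb (FermionTorus 2 L)), φ ∈ szSector N 0 → star φ ⬝ᵥ φ = 1 →
      (star φ ⬝ᵥ (hubbardTorus 2 L 1 U *ᵥ φ)).re ≤ (hubbardTorus 2 L 1 U).minEnergyOn (szSector N 0) + κ →
        a ≤ (expect ((pairField dWaveFormFactor L)ᴴ * pairField dWaveFormFactor L) φ).re / (L : ℝ) ^ 4)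
    (hκ : 16 * Real.pi ^ 2 ≤ κ) (i : Fin 2) {ψ : Fock (Orb (FermionTorus 2 L))}
    (hψ1 : star ψ ⬝ᵥ ψ = 1) (hψ : IsGroundStateInSector (hubbardTorus 2 L 1 U) N 0 ψ) :
    a ≤ (expect ((upPairFieldAt dWaveFormFactor L (Pi.single i 1))ᴴ *
        upPairFieldAt dWaveFormFactor L (Pi.single i 1)) ψ).re / (L : ℝ) ^ 4 ∨
      a ≤ (expect ((upPairFieldAt dWaveFormFactor L (-Pi.single i 1))ᴴ *
        upPairFieldAt dWaveFormFactor L (-Pi.single i 1)) ψ).re / (L : ℝ) ^ 4 := by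
  obtain ⟨hmem, -, heig⟩ := hψ
  set k : TorusSite 2 L := Pi.single i 1 with hk
  set θ := upTwistAngle L k with hθ
  set P₀ := (pairField dWaveFormFactor L)ᴴ * pairField dWaveFormFactor L with hP₀
  set E₀ := (hubbardTorus 2 L 1 U).minEnergyOn (szSector N 0) with hE₀
  -- `ψ` has energy `E₀`
  have hEψ : (star ψ ⬝ᵥ (hubbardTorus 2 L 1 U *ᵥ ψ)).re = E₀ := by
    rw [heig, dotProduct_smul, hψ1, smul_eq_mul, mul_one, Complex.ofReal_re]
  -- the two boosted copies, their energies and zero-mode weights (covariance, on vectors)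
  have hPneg : fockTwist (-θ) * P₀ * fockTwist θ =
      (upPairFieldAt dWaveFormFactor L (-k))ᴴ * upPairFieldAt dWaveFormFactor L (-k) := by
    rw [hθ, ← fockTwist_upTwistAngle_neg, show fockTwist (upTwistAngle L k) =
      fockTwist (-upTwistAngle L (-k)) by rw [← fockTwist_upTwistAngle_neg, neg_neg], hP₀,
      fockTwist_conj_pairPenalty_dWave]
  -- copy 1: `D⁻¹ψ`, energy `e₊ = ⟨D H D⁻¹⟩_ψ`, zero-mode weight `⟨Π_k⟩_ψ`
  have hm1 := fockTwist_mulVec_mem_szSector (-θ) hmem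
  have hu1 : star (fockTwist (-θ) *ᵥ ψ) ⬝ᵥ (fockTwist (-θ) *ᵥ ψ) = 1 := by
    rw [star_mulVec_dotProduct, conjTranspose_fockTwist_mulVec_mulVec, hψ1]
  have hen1 : (star (fockTwist (-θ) *ᵥ ψ) ⬝ᵥ (hubbardTorus 2 L 1 U *ᵥ (fockTwist (-θ) *ᵥ ψ))).re =
      (star ψ ⬝ᵥ ((fockTwist θ * hubbardTorus 2 L 1 U * fockTwist (-θ)) *ᵥ ψ)).re := by
    rw [Matrix.star_mulVec_dotProduct_mulVec, conjTranspose_fockTwist, neg_neg]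
  have hw1 : expect P₀ (fockTwist (-θ) *ᵥ ψ) =
      expect ((upPairFieldAt dWaveFormFactor L k)ᴴ * upPairFieldAt dWaveFormFactor L k) ψ := by
    simp only [Literature.MathematicalPhysics.QuantumLattice.expect]
    rw [Matrix.star_mulVec_dotProduct_mulVec, conjTranspose_fockTwist, neg_neg, hP₀, hθ,
      fockTwist_conj_pairPenalty_dWave]
  -- copy 2: `Dψ`, energy `e₋ = ⟨D⁻¹ H D⟩_ψ`, zero-mode weight `⟨Π_{-k}⟩_ψ`
  have hm2 := fockTwist_mulVec_mem_szSector θ hmem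
  have hu2 : star (fockTwist θ *ᵥ ψ) ⬝ᵥ (fockTwist θ *ᵥ ψ) = 1 := by
    rw [star_mulVec_dotProduct, conjTranspose_fockTwist_mulVec_mulVec, hψ1]
  have hen2 : (star (fockTwist θ *ᵥ ψ) ⬝ᵥ (hubbardTorus 2 L 1 U *ᵥ (fockTwist θ *ᵥ ψ))).re =
      (star ψ ⬝ᵥ ((fockTwist (-θ) * hubbardTorus 2 L 1 U * fockTwist θ) *ᵥ ψ)).re := by
    rw [Matrix.star_mulVec_dotProduct_mulVec, conjTranspose_fockTwist]
  have hw2 : expect P₀ (fockTwist θ *ᵥ ψ) =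
      expect ((upPairFieldAt dWaveFormFactor L (-k))ᴴ * upPairFieldAt dWaveFormFactor L (-k)) ψ := by
    simp only [Literature.MathematicalPhysics.QuantumLattice.expect]
    rw [Matrix.star_mulVec_dotProduct_mulVec, conjTranspose_fockTwist, hPneg]
  -- LSM: `e₊ + e₋ = 2E₀ + 2⟨P_θ⟩_ψ ≤ 2E₀ + 32π²`
  have htwo : ∀ z : ℂ, ((2 : ℂ) * z).re = 2 * z.re := fun z => by simp [Complex.mul_re]
  have hsum := congrArg (fun T => (star ψ ⬝ᵥ (T *ᵥ ψ)).re)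
    (frameHamiltonian_add_frameHamiltonian_neg L U k)
  simp only [add_mulVec, dotProduct_add, Complex.add_re, smul_mulVec, dotProduct_smul, smul_eq_mul,
    htwo] at hsum
  rw [← hθ, hEψ] at hsum
  have hP := re_expect_lsmPerturbation_single_le L hL i ψ
  rw [hψ1, Complex.one_re, mul_one, ← hk, ← hθ] at hP
  -- one of the two copies is within `κ` of `E₀`
  by_cases hcase : (star ψ ⬝ᵥ ((fockTwist θ * hubbardTorus 2 L 1 U * fockTwist (-θ)) *ᵥ ψ)).re ≤ E₀ + κ
  · left
    have h := hrig _ hm1 hu1 (by rw [hen1]; exact hcase)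
    rwa [hw1] at h
  · right
    have hcase' : (star ψ ⬝ᵥ ((fockTwist (-θ) * hubbardTorus 2 L 1 U * fockTwist θ) *ᵥ ψ)).re ≤ E₀ + κ := by
      push Not at hcase
      linarith
    have h := hrig _ hm2 hu2 (by rw [hen2]; exact hcase')
    rwa [hw2] at h

end Summit.HubbardSuperconductivity.HubbardSuperconductivity.Theorems.PinnedFrame
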